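/-
Copyright (c) 2026 the pub-hodgecm-mathlib formalisation cell (harness21).  Prover seat hodgecm-mathlib-K2E5-p16 (g8): Track B «K2-LIT»,
hLiu418 = stmt-HodgeConjecture-24832; LEAD F0P6-plan (g14) BATCH #85 (1) «K1-a♮» (line lead K2E5-p16 (g8)), organ (K1a-GK), file (K1a-2d) brick 1: the (σ) seam.
-/
import Summits.HodgeConjecture.HodgeConjecture.Theorems.K2LiuA7NormalisedRegularityCM              -- ★ B8-CM `exists_adaptedFrame` (pattern of §1), ★ frame algebra
import Summits.HodgeConjecture.HodgeConjecture.Theorems.K2LiuSiegelUnipotentCharacterFactorisation  -- ★ (d1) `unipDeltaChar_locToAdelic_eq_prod`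
import Summits.HodgeConjecture.HodgeConjecture.Theorems.K2LiuUnipDeltaLocBridge                     -- ★ B1 §3 `trace_mul_toBlocks₁₂_component_nElem`
import Summits.HodgeConjecture.HodgeConjecture.Theorems.K2LiuUnipDeltaLocalCoordinates              -- ★ O41.5c `eq_nElem_of_mem_unipDeltaLocal`, `blkB_matA_nElem`
import Summits.HodgeConjecture.HodgeConjecture.Theorems.K2LiuLocalWhittakerFactorSkew               -- ★ `map_adeleEval_map_algebraMap`
import Summits.HodgeConjecture.HodgeConjecture.Theorems.K2LiuTateCharacterLocalTrace                 -- ★ `prod_adicComponent_adeleAddChar_eq`, local trace letters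
import Summits.HodgeConjecture.HodgeConjecture.Theorems.K2LiuDoubledUTwoTwoFrameTransport             -- ★ `adapt_matA_frameConj_nSiegel`, `frameConj_nSiegel_mem_unipDeltaLocal`
import Literature.NumberTheory.GelbartRogawski1991.LocalKudlaSplittingInjectiveTransported    -- ★ `gramR_eq_diagonal`
import Summits.HodgeConjecture.HodgeConjecture.Theorems.K2LiuUnipDeltaRankOneCoordinates             -- ★ `conjLocal_coord`
import Summits.HodgeConjecture.HodgeConjecture.Theorems.K2LiuDoubledUTwoTwoUnipotentCoordinates       -- ★ `blkB_matA_frameConj_nSiegel`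
import HarnessLib

/-!
# Crux `HLiu418`, road `K2_Liu`, socket #41 KIND 1 a♮, organ (K1a-GK), file (K1a-2d) brick 1 — THE CORNER CHARACTER IN THE COCYCLE FRAME (the seam (σ)):
# `ψ_S(ι_v u) = ψ_v(Tr(−½·tr(S·B(u))))` on `N_Δ(L⁺_v)`, and the Δ-adapted frame with its inverse block `D⁻¹ = 2·W·T₀` EXPOSED

Cell `hodgecm-mathlib`, crux item hLiu418 = `stmt-HodgeConjecture-24832`; squad K2 ∕ K2Liu; prover K2E5-p16 (g8) = line lead of K1-a♮ (LEAD F0P6-plan (g14)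
BATCH #85 (1)); K1 desk F0P2-p11 (g2); consumers (K1a-2d) ED. 2 `K2LiuRankOneSingularLocalValueCM` (me), (K1a-♮) LH4-p07 (g11) (Q4), row (5) LH4-p11 (g10).
THEOREMS ONLY (no `def`, no instance, no notation, no named-fact hypothesis, no `sorry`); lane `--supports stmt-HodgeConjecture-24832 --as helper` (count-neutral helper).

THE SEAM (σ) (census `K2/K2E5-p16/g8/CENSUS-K1a-GK.K2E5-p16-g8.md` 7c6ffe7718f089b5 §3, line lead WORD #2).  ★ G1's local factor at a Fourier index `S` carries the GLOBAL
character at local points, `conj ψ_S(ι_v y)`; the producer ★ (K1a-2b) p862724 `K2LiuRankOneSingularLocalValue` twists by a LOCAL additive character of the first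
cocycle coordinate, `ψ_v(b₁(u)·τ)`.  This file reads the former in local coordinates:
* §1 **`exists_adaptedFrame_eq`** (any `n`, `T₀` symmetric with unit determinant) — ★ B8-CM `exists_adaptedFrame` with the blocks EXPOSED:
  `D = ½·T₀⁻¹·W`, `D⁻¹ = 2·W·T₀` (`W` the antidiagonal permutation), so for DIAGONAL `T₀` both are antidiagonal (`apply_eq_zero_of_diagonal`: `(2·W·T₀) i i' = 0`
  unless `i' = rev i`; `two_mul_rev_mul_apply`).
* §2 **`unipDeltaChar_locToAdelic_nElem`** (CM datum, any rank) — for a `T`-skew local block `t` and ★ `n(t) ∈ N_Δ(L⁺_v)`: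
  `ψ_S(ι_v n(t)) = ψ_{L⁺,v}(Tr_{L⊗L⁺_v ∕ L⁺_v}(−½ · tr(S·t)))` (★ (d1) `unipDeltaChar_locToAdelic_eq_prod` — Tate's product over `w ∣ v` —, ★ B1 §3
  `trace_mul_toBlocks₁₂_component_nElem` — the e₂-corner of `n(t)_w` is `−½ t_w` —, ★ `map_adeleEval_map_algebraMap`, ★ `prod_adicComponent_adeleAddChar_eq` — `∏_{w∣v} ψ_{L,w} =
  ψ_{L⁺,v} ∘ Tr`); **`unipDeltaChar_locToAdelic_of_mem_unipDeltaLocal`** — the same for every `u ∈ N_Δ(L⁺_v)` with `t := B(u)` (★ `eq_nElem_of_mem_unipDeltaLocal`).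
HONEST LABEL.  `HC_CM` is proved only modulo the 7 printed citations (2 remaining named inputs: hLiu418 = `stmt-HodgeConjecture-24832`,
h413 = `stmt-HodgeConjecture-24833`) until rung 0 closes.

## References
* [HarrisKudlaSweet1996] M. Harris, S. Kudla, W. J. Sweet, J. AMS 9 (1996), §1 (1.11)–(1.12) (the adapted frame, `N_Δ ≅ Herm_n`).
* [Shimura1997] G. Shimura, *Euler Products and Eisenstein Series*, CBMS 93 (1997), §18.1 (18.4) (the local character `ψ(tr(S·X))`).
* [CasselsFrohlichANT1967] Cassels–Fröhlich (eds.), *Algebraic Number Theory* (1967), Ch. XV (Tate) §2.2, §4.1, Lemma 3.2.1; Ch. II §11 (local trace).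
* [Kudla1994] S. Kudla, Israel J. Math. 87 (1994), §3.
-/

set_option autoImplicit false
set_option linter.dupNamespace false -- the mandated namespace repeats `HodgeConjecture.HodgeConjecture`

noncomputable section

open scoped NNReal ENNReal ComplexConjugate
open NumberField IsDedekindDomain Matrix
open Literature.NumberTheory.Automorphic Literature.NumberTheory.Automorphic.UnitaryGroup Literature.NumberTheory.GaloisRepresentations
open Literature.NumberTheory.GelbartRogawski1991 Literature.NumberTheory.GelbartRogawski1991.GRConstruction
open Literature.NumberTheory.GelbartRogawski1991.AdaptedBlocks
open Literature.NumberTheory.GelbartRogawski1991.UnitaryDualPair Literature.NumberTheory.GelbartRogawski1991.UnitaryDualPair.LocalSplitting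
open Literature.NumberTheory.K2Lit Literature.NumberTheory.K2Lit.SiegelDoubled Literature.NumberTheory.K2Lit.LocalSiegelDoubled
open Summit.HodgeConjecture.HodgeConjecture.Cruxes.HLiu418.K2LiuLocalSiegelIwasawaFrame
open Summit.HodgeConjecture.HodgeConjecture.Cruxes.HLiu418.K2LiuLocalSiegelIwasawa
open Summit.HodgeConjecture.HodgeConjecture.Cruxes.HLiu418.K2LiuDoubledUTwoTwoWeylCocycle
open Summit.HodgeConjecture.HodgeConjecture.Cruxes.HLiu418.K2LiuDoubledUTwoTwoLevi
open Summit.HodgeConjecture.HodgeConjecture.Cruxes.HLiu418.K2LiuUnipDeltaRankOneCoordinates (conjLocal_coord)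
open Summit.HodgeConjecture.HodgeConjecture.Cruxes.HLiu418.K2LiuSiegelUnipotentFourierDefs
open Summit.HodgeConjecture.HodgeConjecture.Cruxes.HLiu418.K2LiuSiegelUnipotentCharacters
open Summit.HodgeConjecture.HodgeConjecture.Cruxes.HLiu418.K2LiuSiegelUnipotentCharacterFactorisation (unipDeltaChar_locToAdelic_eq_prod)
open Summit.HodgeConjecture.HodgeConjecture.Cruxes.HLiu418.K2LiuUnipDeltaLocBridge (trace_mul_toBlocks₁₂_component_nElem)
open Summit.HodgeConjecture.HodgeConjecture.Cruxes.HLiu418.K2LiuUnipDeltaLocalCoordinates (eq_nElem_of_mem_unipDeltaLocal skew_blkB_of_mem_unipDeltaLocal)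
open Summit.HodgeConjecture.HodgeConjecture.Cruxes.HLiu418.K2LiuLocalWhittakerFactorSkew (map_adeleEval_map_algebraMap)
open Summit.HodgeConjecture.HodgeConjecture.Cruxes.HLiu418.K2LiuTateCharacterLocalTrace (prod_adicComponent_adeleAddChar_eq)
open Summit.HodgeConjecture.HodgeConjecture.Cruxes.HLiu418.K2LiuDoubledUTwoTwoBorelFrame
open Summit.HodgeConjecture.HodgeConjecture.Cruxes.HLiu418.K2LiuDoubledUTwoTwoFrameTransport

namespace Summit.HodgeConjecture.HodgeConjecture.Cruxes.HLiu418.K2LiuRankOneCornerCharacterReading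

/-! ## §1 The Δ-adapted frame with its blocks exposed -/

section Frame

variable (F : Type) [Field F] [NumberField F] (n : ℕ) {T₀ : Matrix (Fin n) (Fin n) F}

/-- **THE Δ-ADAPTED FRAME WITH EXPLICIT BLOCKS** (★ B8-CM `exists_adaptedFrame`, same witnesses, the two blocks now NAMED in the conclusion): for `T₀` symmetric with
`det T₀` a unit, `D := ½·T₀⁻¹·W`, `D⁻¹ := 2·W·T₀` (`W = 1.submatrix Fin.rev id` the antidiagonal permutation) and `Q := e₂ ∘ (1 D; 1 −D)` satisfy the seven frame letters
`D D⁻¹ = 1`, `D⁻¹ D = 1`, `Q = e₂∘(1 D; 1 −D)`, `Qᵀ (T₀ ⊕ −T₀) Q = J_{2n}`. [cite: HarrisKudlaSweet1996, §1 (1.11)] -/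
theorem exists_adaptedFrame_eq (hT₀ : T₀.IsSymm) (hT₀d : IsUnit T₀.det) :
    ∃ (D Dinv : Matrix (Fin n) (Fin n) F) (Q : GL (Fin (n + n)) F), D * Dinv = 1 ∧ Dinv * D = 1 ∧
      (Q : Matrix (Fin (n + n)) (Fin (n + n)) F) = Matrix.reindex (e₂ n) (e₂ n) (Matrix.fromBlocks 1 D 1 (-D)) ∧
      (Q : Matrix (Fin (n + n)) (Fin (n + n)) F)ᵀ * LocalSplitting.gramD F n T₀ * (Q : Matrix (Fin (n + n)) (Fin (n + n)) F) = (StdForm.antidiagonal (n + n)).over F ∧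
      D = (2 : F)⁻¹ • (T₀⁻¹ * (1 : Matrix (Fin n) (Fin n) F).submatrix id Fin.rev) ∧
      Dinv = (2 : F) • ((1 : Matrix (Fin n) (Fin n) F).submatrix Fin.rev id * T₀) := by
  obtain ⟨D, hD⟩ : ∃ D : Matrix (Fin n) (Fin n) F, D = (2 : F)⁻¹ • (T₀⁻¹ * (1 : Matrix (Fin n) (Fin n) F).submatrix id Fin.rev) := ⟨_, rfl⟩
  obtain ⟨Qm, hQm⟩ : ∃ Qm : Matrix (Fin (n + n)) (Fin (n + n)) F, Qm = Matrix.reindex (e₂ n) (e₂ n) (Matrix.fromBlocks 1 D 1 (-D)) := ⟨_, rfl⟩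
  obtain ⟨Qi, hQi⟩ : ∃ Qi : Matrix (Fin (n + n)) (Fin (n + n)) F, Qi = Matrix.reindex (e₂ n) (e₂ n)
      (Matrix.fromBlocks ((2 : F)⁻¹ • (1 : Matrix (Fin n) (Fin n) F)) ((2 : F)⁻¹ • 1)
        ((1 : Matrix (Fin n) (Fin n) F).submatrix Fin.rev id * T₀) (-((1 : Matrix (Fin n) (Fin n) F).submatrix Fin.rev id * T₀))) := ⟨_, rfl⟩
  have hmul : Qm * Qi = 1 := by
    rw [hQm, hQi, reindex_mul_reindex, hD, frame_mul_frameInv hT₀d, Matrix.reindex_apply, Matrix.submatrix_one_equiv]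
  have hmul' : Qi * Qm = 1 := by
    rw [hQm, hQi, reindex_mul_reindex, hD, frameInv_mul_frame hT₀d, Matrix.reindex_apply, Matrix.submatrix_one_equiv]
  have hQ : Qmᵀ * LocalSplitting.gramD F n T₀ * Qm = (StdForm.antidiagonal (n + n)).over F := by
    rw [hQm, LocalSplitting.gramD, Matrix.transpose_reindex, reindex_mul_reindex, reindex_mul_reindex, hD, frame_transpose_mul_gram_mul_frame hT₀ hT₀d,
      reindex_antidiag_eq_antidiagonal_over]
  have hDG : D * ((2 : F) • ((1 : Matrix (Fin n) (Fin n) F).submatrix Fin.rev id * T₀)) = 1 := by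
    rw [hD, Matrix.smul_mul, Matrix.mul_smul, smul_smul, inv_mul_cancel₀ (two_ne_zero : (2 : F) ≠ 0), one_smul, Matrix.mul_assoc,
      ← Matrix.mul_assoc ((1 : Matrix (Fin n) (Fin n) F).submatrix id Fin.rev), antidiag_mul_antidiag, Matrix.one_mul, Matrix.nonsing_inv_mul T₀ hT₀d]
  have hGD : ((2 : F) • ((1 : Matrix (Fin n) (Fin n) F).submatrix Fin.rev id * T₀)) * D = 1 := by
    rw [hD, Matrix.smul_mul, Matrix.mul_smul, smul_smul, mul_inv_cancel₀ (two_ne_zero : (2 : F) ≠ 0), one_smul, Matrix.mul_assoc,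
      ← Matrix.mul_assoc T₀, Matrix.mul_nonsing_inv T₀ hT₀d, Matrix.one_mul, antidiag_mul_antidiag']
  exact ⟨D, (2 : F) • ((1 : Matrix (Fin n) (Fin n) F).submatrix Fin.rev id * T₀), ⟨Qm, Qi, hmul, hmul'⟩, hDG, hGD, hQm, hQ, hD, rfl⟩

omit [NumberField F] in
/-- **`(2·W·T₀) i j = 2 · T₀ (rev i) j`** — the rows of `W·T₀` are the rows of `T₀` reversed. [cite: HarrisKudlaSweet1996, §1 (1.11)] -/
theorem two_smul_rev_mul_apply (T : Matrix (Fin n) (Fin n) F) (i j : Fin n) :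
    ((2 : F) • ((1 : Matrix (Fin n) (Fin n) F).submatrix Fin.rev id * T)) i j = 2 * T (Fin.rev i) j := by
  rw [Matrix.smul_apply, smul_eq_mul, Matrix.mul_apply, Finset.sum_eq_single (Fin.rev i)]
  · rw [Matrix.submatrix_apply, id, Matrix.one_apply_eq, one_mul]
  · intro k _ hk
    rw [Matrix.submatrix_apply, id, Matrix.one_apply_ne (fun h => hk h.symm), zero_mul]
  · exact fun h => (h (Finset.mem_univ _)).elim

omit [NumberField F] in
/-- **for DIAGONAL `T₀` the inverse block `2·W·T₀` is ANTIDIAGONAL**: `(2·W·diag(t)) i j = 0` unless `j = rev i`, and `(2·W·diag(t)) i (rev i) = 2·t(rev i)`.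
[cite: HarrisKudlaSweet1996, §1 (1.11)] -/
theorem two_smul_rev_mul_diagonal_apply (t : Fin n → F) (i j : Fin n) :
    ((2 : F) • ((1 : Matrix (Fin n) (Fin n) F).submatrix Fin.rev id * Matrix.diagonal t)) i j = if j = Fin.rev i then 2 * t j else 0 := by
  rw [two_smul_rev_mul_apply, Matrix.diagonal_apply]
  by_cases h : j = Fin.rev i
  · rw [if_pos h.symm, if_pos h, h]
  · rw [if_neg (fun h' => h h'.symm), if_neg h, mul_zero]

end Frame

/-! ## §2 The global character at local unipotent points, read in the adapted block `B(u)` -/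

section Character

variable (L : Type) [Field L] [NumberField L] [IsCMField L] {N M n : ℕ} (e : Fin N × Fin M ≃ Fin n)
  (dV : Fin N → L) (hdV : ∀ i, IsCMField.complexConj L (dV i) = dV i)
  (dW : Fin M → L) (hdW : ∀ i, IsCMField.complexConj L (dW i) = dW i)
  (v : HeightOneSpectrum (𝓞 (Fp L))) (S : Matrix (Fin n) (Fin n) L)

/-- **`ψ_S(ι_v n(t)) = ψ_{L⁺,v}(Tr(−½ · tr(S·t)))`** for a `T`-skew local block `t` (`n(t)` = ★ `nElem`): Tate's product formula localised at `v` (★ (d1)), the e₂-corner of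
`n(t)_w` (★ B1 §3), and the local trace compatibility `∏_{w∣v} ψ_{L,w} = ψ_{L⁺,v} ∘ Tr_{L⊗L⁺_v∕L⁺_v}` (★ `prod_adicComponent_adeleAddChar_eq`).
[cite: Shimura1997, §18.1 (18.4)] [cite: CasselsFrohlichANT1967, Ch. XV (Tate) Lemma 3.2.1, §2.2] -/
theorem unipDeltaChar_locToAdelic_nElem {t : Matrix (Fin n) (Fin n) (LocalRing L v)}
    (ht : (t.map (conjLocal L (IsCMField.complexConj L) v))ᵀ * gramS (Fp L) L v n (gramR L e dV hdV dW hdW) +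
      gramS (Fp L) L v n (gramR L e dV hdV dW hdW) * t = 0) :
    unipDeltaChar L e dV hdV dW hdW S (locToAdelic L e dV hdV dW hdW v
        (nElem (Fp L) L (IsCMField.complexConj L) v n (hermD_eq_map_gramD L e dV hdV dW hdW) t ht)) =
      adeleAddCharAt (Fp L) v (Algebra.trace (v.adicCompletion (Fp L)) (LocalRing L v)
        (-(⅟(2 : LocalRing L v) * Matrix.trace (S.map (algebraMap L (LocalRing L v)) * t)))) := by
  rw [unipDeltaChar_locToAdelic_eq_prod, ← prod_adicComponent_adeleAddChar_eq (F := Fp L) L v]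
  refine Finset.prod_congr rfl fun w _ => ?_
  rw [map_adeleEval_map_algebraMap, trace_mul_toBlocks₁₂_component_nElem (Fp L) L (IsCMField.complexConj L) v n (hermD_eq_map_gramD L e dV hdV dW hdW) ht w,
    Pi.neg_apply, Pi.mul_apply]

/-- **`ψ_S(ι_v u) = ψ_{L⁺,v}(Tr(−½ · tr(S·B(u))))` for every `u ∈ N_Δ(L⁺_v)`**, `B(u) = blkB (matA u)` its adapted block (★ `eq_nElem_of_mem_unipDeltaLocal`: `u = n(B(u))`).
[cite: Shimura1997, §18.1 (18.4)] [cite: HarrisKudlaSweet1996, §1 (1.11)] -/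
theorem unipDeltaChar_locToAdelic_of_mem_unipDeltaLocal
    {u : UnitaryGroup.localPi L (IsCMField.complexConj L) (n + n) (hermD L e dV hdV dW hdW) v}
    (hu : u ∈ unipDeltaLocal (Fp L) L (IsCMField.complexConj L) v n (JD := hermD L e dV hdV dW hdW)) :
    unipDeltaChar L e dV hdV dW hdW S (locToAdelic L e dV hdV dW hdW v u) =
      adeleAddCharAt (Fp L) v (Algebra.trace (v.adicCompletion (Fp L)) (LocalRing L v)
        (-(⅟(2 : LocalRing L v) * Matrix.trace (S.map (algebraMap L (LocalRing L v)) *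
          blkB (matA (Fp L) L (IsCMField.complexConj L) v n u))))) := by
  have h := unipDeltaChar_locToAdelic_nElem L e dV hdV dW hdW v S (skew_blkB_of_mem_unipDeltaLocal (Fp L) L (IsCMField.complexConj L) v n
    (hermD_eq_map_gramD L e dV hdV dW hdW) hu)
  rwa [← eq_nElem_of_mem_unipDeltaLocal (Fp L) L (IsCMField.complexConj L) v n (hermD_eq_map_gramD L e dV hdV dW hdW) hu] at h

end Character

/-! ## §3 Rank two, ONE FRAME: the corner index `single 1 1 σ` pairs with the innermost cocycle letter only -/

section Corner

/-- `tr(single 1 1 a · M) = a · M 1 1` (`2 × 2`). [folklore] -/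
theorem trace_single_one_one_mul {R : Type*} [CommRing R] (a : R) (M : Matrix (Fin 2) (Fin 2) R) :
    Matrix.trace (Matrix.single (1 : Fin 2) (1 : Fin 2) a * M) = a * M 1 1 := by
  rw [Matrix.trace, Fin.sum_univ_two]
  simp only [Matrix.diag_apply, Matrix.mul_apply, Fin.sum_univ_two, Matrix.single_apply]
  simp only [Fin.one_eq_zero_iff, OfNat.ofNat_ne_one, and_true, and_false, ↓reduceIte, zero_mul, add_zero, zero_add, and_self]

/-- `(single i j a).map f = single i j (f a)` for a ring hom `f`. [folklore] -/
theorem single_map_ringHom {R R' : Type*} [CommRing R] [CommRing R'] (f : R →+* R') (i j : Fin 2) (a : R) :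
    (Matrix.single i j a).map f = Matrix.single i j (f a) := by
  ext i' j'
  simp only [Matrix.map_apply, Matrix.single_apply]
  split_ifs <;> simp

/-- `(!![z, y; x, w] · N) 1 1 = x · N 0 1 + w · N 1 1`. [folklore] -/
theorem twoByTwo_mul_apply_one_one {R : Type*} [CommRing R] (z y x w : R) (N : Matrix (Fin 2) (Fin 2) R) :
    (!![z, y; x, w] * N) 1 1 = x * N 0 1 + w * N 1 1 := by
  rw [Matrix.mul_apply, Fin.sum_univ_two]
  simp only [Matrix.of_apply, Matrix.cons_val', Matrix.cons_val_zero, Matrix.cons_val_one, Matrix.cons_val_fin_one, Matrix.empty_val']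

end Corner

section CornerCM

variable (L : Type) [Field L] [NumberField L] [IsCMField L] {N M : ℕ} (e : Fin N × Fin M ≃ Fin 2)
  (dV : Fin N → L) (hdV : ∀ i, IsCMField.complexConj L (dV i) = dV i)
  (dW : Fin M → L) (hdW : ∀ i, IsCMField.complexConj L (dW i) = dW i)
  (v : HeightOneSpectrum (𝓞 (Fp L)))
  (D Dinv : Matrix (Fin 2) (Fin 2) (Fp L)) (hDD : D * Dinv = 1) (Q : GL (Fin (2 + 2)) (Fp L))
  (hQm : (Q : Matrix (Fin (2 + 2)) (Fin (2 + 2)) (Fp L)) = Matrix.reindex (e₂ 2) (e₂ 2) (Matrix.fromBlocks 1 D 1 (-D)))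
  (hQ : (Q : Matrix (Fin (2 + 2)) (Fin (2 + 2)) (Fp L))ᵀ * LocalSplitting.gramD (Fp L) 2 (gramR L e dV hdV dW hdW) * (Q : Matrix (Fin (2 + 2)) (Fin (2 + 2)) (Fp L)) =
    (StdForm.antidiagonal (2 + 2)).over (Fp L))
  (hDinv : Dinv = (2 : Fp L) • ((1 : Matrix (Fin 2) (Fin 2) (Fp L)).submatrix Fin.rev id * gramR L e dV hdV dW hdW))

include hDinv in
/-- in the frame of §1 at the (diagonal) CM Gram datum: `(D⁻¹)_v 1 1 = 0` and `(D⁻¹)_v 0 1 = ι_v(2·t₁)`, `t₁ = gramR 1 1`. [cite: HarrisKudlaSweet1996, §1 (1.11)] -/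
theorem map_Dinv_apply (i' : Fin 2) :
    (Dinv.map ((UnitaryGroup.toLocalRing L v).comp (algebraMap (Fp L) (v.adicCompletion (Fp L))))) i' 1 =
      if i' = 0 then UnitaryGroup.toLocalRing L v (algebraMap (Fp L) (v.adicCompletion (Fp L)) (2 * gramR L e dV hdV dW hdW 1 1)) else 0 := by
  rw [Matrix.map_apply, hDinv, gramR_eq_diagonal, two_smul_rev_mul_diagonal_apply]
  fin_cases i'
  · simp only [Fin.zero_eta, Fin.isValue, Fin.rev_zero, Fin.last, Fin.reduceFinMk, ↓reduceIte, RingHom.coe_comp, Function.comp_apply,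
      Matrix.diagonal_apply_eq]
  · have hrev : Fin.rev (1 : Fin 2) = 0 := by decide
    simp only [Fin.mk_one, Fin.isValue, hrev, show (1 : Fin 2) ≠ 0 from one_ne_zero, ↓reduceIte, map_zero]

include hDD hQm hDinv in
/-- **THE CORNER CHARACTER IN THE COCYCLE FRAME, CM DATUM** (the seam (σ)): for the corner index `S♭ = single 1 1 σ` and the frame letter
`u = φ(n(ι_v(b₁)δ, z, ι_v(b₂)δ))` of ★ B4d-3's coordinates (frame of §1 at the diagonal Gram datum, `δ = imagUnit L`),
**`conj ψ_{S♭}(ι_v u) = ψ_{L⁺,v}(b₁ · ι_v(t₁ · Tr_{L∕L⁺}(σ·δ)))`**, `t₁ = gramR 1 1` — the twist depends ONLY on the innermost letter `b₁` (the `(1,0)` slot of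
`!![z, ι b₂ δ; ι b₁ δ, −z̄]`, since `(D⁻¹)_v 1 1 = 0`), with `τ := t₁ · Tr_{L∕L⁺}(σδ) ∈ L⁺` (`= 2t₁σδ` for imaginary `σ`).
[cite: Shimura1997, §18.1 (18.4)] [cite: HarrisKudlaSweet1996, §1 (1.11)–(1.12)] [cite: CasselsFrohlichANT1967, Ch. XV (Tate) Lemma 3.2.1] -/
theorem conj_unipDeltaChar_single_locToAdelic_frameConj_nSiegel (σ : L) (b₁ : v.adicCompletion (Fp L)) (z : UnitaryGroup.LocalRing L v)
    (b₂ : v.adicCompletion (Fp L)) :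
    haveI : Algebra.IsQuadraticExtension (Fp L) L := IsCMField.isQuadraticExtension L
    conj (((unipDeltaChar L e dV hdV dW hdW (Matrix.single 1 1 σ) (locToAdelic L e dV hdV dW hdW v
        (FrameTransport.frameConj (Fp L) L (IsCMField.complexConj L) v (2 + 2) (hermD_eq_map_gramD L e dV hdV dW hdW) (antidiagonal_over_eq_map (Fp L) L 2) Q hQ
          (toLocalFour (Fp L) L (IsCMField.complexConj L) v
            (nSiegel (UnitaryGroup.LocalRing L v) (UnitaryGroup.conjLocal L (IsCMField.complexConj L) v)
              (UnitaryGroup.conjLocal_conjLocal (IsCMField.complexConj L) v (complexConj_imagUnit L) (imagUnit_ne_zero L))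
              (UnitaryGroup.toLocalRing L v b₁ * algebraMap L (UnitaryGroup.LocalRing L v) (imagUnit L)) z
              (UnitaryGroup.toLocalRing L v b₂ * algebraMap L (UnitaryGroup.LocalRing L v) (imagUnit L))
              (conjLocal_coord (Fp L) L (IsCMField.complexConj L) (complexConj_imagUnit L) v b₁)
              (conjLocal_coord (Fp L) L (IsCMField.complexConj L) (complexConj_imagUnit L) v b₂)))))) : Circle) : ℂ) =
      ((adeleAddCharAt (Fp L) v (b₁ * algebraMap (Fp L) (v.adicCompletion (Fp L))
        (gramR L e dV hdV dW hdW 1 1 * Algebra.trace (Fp L) L (σ * imagUnit L))) : Circle) : ℂ) := by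
  haveI : Algebra.IsQuadraticExtension (Fp L) L := IsCMField.isQuadraticExtension L
  rw [unipDeltaChar_locToAdelic_of_mem_unipDeltaLocal L e dV hdV dW hdW v (Matrix.single 1 1 σ)
      (frameConj_nSiegel_mem_unipDeltaLocal (Fp L) L (IsCMField.complexConj L) (complexConj_imagUnit L) (imagUnit_ne_zero L) v
        (hermD_eq_map_gramD L e dV hdV dW hdW) D Dinv hDD Q hQm hQ _ z _ _ _),
    K2LiuDoubledUTwoTwoUnipotentCoordinates.blkB_matA_frameConj_nSiegel (Fp L) L (IsCMField.complexConj L) (complexConj_imagUnit L) (imagUnit_ne_zero L) v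
      (hermD_eq_map_gramD L e dV hdV dW hdW) D Dinv hDD Q hQm hQ,
    single_map_ringHom, trace_single_one_one_mul, twoByTwo_mul_apply_one_one,
    map_Dinv_apply L e dV hdV dW hdW v Dinv hDinv 0, map_Dinv_apply L e dV hdV dW hdW v Dinv hDinv 1, if_pos rfl, if_neg one_ne_zero, mul_zero, add_zero]
  -- the element `−½ · σ · (ι b₁ δ) · ι(2 t₁) = −(ι(b₁ t₁) · (σδ ⊗ 1))` of `L ⊗ L⁺_v` and its trace
  have helt : -(⅟(2 : UnitaryGroup.LocalRing L v) * (algebraMap L (UnitaryGroup.LocalRing L v) σ *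
      ((UnitaryGroup.toLocalRing L v b₁ * algebraMap L (UnitaryGroup.LocalRing L v) (imagUnit L)) *
        UnitaryGroup.toLocalRing L v (algebraMap (Fp L) (v.adicCompletion (Fp L)) (2 * gramR L e dV hdV dW hdW 1 1))))) =
      UnitaryGroup.toLocalRing L v (-(b₁ * algebraMap (Fp L) (v.adicCompletion (Fp L)) (gramR L e dV hdV dW hdW 1 1))) *
        algebraMap L (UnitaryGroup.LocalRing L v) (σ * imagUnit L) := by
    have h2 : UnitaryGroup.toLocalRing L v (algebraMap (Fp L) (v.adicCompletion (Fp L)) 2) = 2 := by rw [map_ofNat, map_ofNat]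
    rw [map_mul (algebraMap (Fp L) (v.adicCompletion (Fp L))), map_mul (UnitaryGroup.toLocalRing L v), h2, map_neg, map_mul, map_mul]
    have hinv : ⅟(2 : UnitaryGroup.LocalRing L v) * 2 = 1 := invOf_mul_self' _
    linear_combination (-(algebraMap L (UnitaryGroup.LocalRing L v) σ * (UnitaryGroup.toLocalRing L v b₁ * algebraMap L (UnitaryGroup.LocalRing L v) (imagUnit L)) *
      UnitaryGroup.toLocalRing L v (algebraMap (Fp L) (v.adicCompletion (Fp L)) (gramR L e dV hdV dW hdW 1 1)))) * hinv
  rw [helt, Summit.HodgeConjecture.HodgeConjecture.Cruxes.HLiu418.K2LiuTateCharacterLocalTrace.algebraTrace_toLocalRing_mul,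
    Summit.HodgeConjecture.HodgeConjecture.Cruxes.HLiu418.K2LiuTateCharacterLocalTrace.algebraTrace_localRing_algebraMap, neg_mul,
    AddChar.map_neg_eq_inv, Circle.coe_inv_eq_conj, Complex.conj_conj, map_mul (algebraMap (Fp L) (v.adicCompletion (Fp L))), ← mul_assoc]
  rfl

end CornerCM


end Summit.HodgeConjecture.HodgeConjecture.Cruxes.HLiu418.K2LiuRankOneCornerCharacterReading

end
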